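import Summits.BirchSwinnertonDyer.BirchSwinnertonDyer.Theorems.ByReductionTypeAtTwoRankOneAtTwoOneDoorLawDefs
import Summits.BirchSwinnertonDyer.Rank1Residual.X11b.BDPRouteManin
import Summits.BirchSwinnertonDyer.Rank1Residual.X5.RationalTwoTorsionPoints
import Summits.BirchSwinnertonDyer.Rank1Residual.F1Sign2.EggLemmaAtTwoProofs
import Literature.NumberTheory.EllipticCurves.NeronIsogenyScalingHoldsProofs
import HarnessLib

/-!
# Route ByReductionTypeAtTwo, crux `RankOneAtTwoBigImageOddLocal` (stmt-BirchSwinnertonDyer-23715), LINE v8 `one_door_analytic`: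
# the MANIN stub split — odd parametrisation constant is PRINT at `4 ∤ N`, OPEN only at additive level `4 ∣ N`

Lead prover seat `bsd-line-fkl-p1` g6 (2026-08-28), skeleton v8.3.  The registered stub `stub_manin : S_manin` («on the
`E(ℚ)[2] = 0` locus some parametrisation datum of level `N_E` has ODD constant») is DERIVED here from

* `S_maninPub` (PRINT: modularity as a newform, Abbes–Ullmo 1996 Thm. A, Česnavičius 2018 Thm. 1.2 — named facts), and
* `@[conjecture] ManinOddAdditiveLevelAtTwo` (the OPEN residue: the same statement at `4 ∣ N_E` only),

both tree names (`…OneDoorLawDefs.lean` APPEND #4).  Kernel content (`exists_modularParametrizationData_not_two_dvd`, the `p = 2`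
twin of `X11b.exists_modularParametrizationData_not_dvd`): the optimal curve `E₀ ~ E` has a lattice-optimal datum
(`Λ_{E₀} = c₀ Λ_f`, minimal degree), `2 ∤ c₀` by Abbes–Ullmo (`2 ∤ N`) / Česnavičius (`2 ∥ N`), and since `E[2]` is irreducible
(`E(ℚ)[2] = 0`) the Néron mapping property gives an ODD integral multiplier `k : Λ_{E₀} → Λ_E`
(`X11b.exists_int_mul_mem_lattice_not_dvd`), whence the datum `(f, Λ_E, k c₀)` of `E` with odd constant.  BSD is not proved by
any of this.
-/

set_option autoImplicit false

noncomputable section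

open scoped Classical

set_option linter.dupNamespace false

namespace Summit.BirchSwinnertonDyer.BirchSwinnertonDyer.Theorems.RankOneAtTwoOneDoor

open WeierstrassCurve NumberField Literature.NumberTheory.EllipticCurves
  Literature.NumberTheory.EllipticCurves.ModularForms
  Literature.NumberTheory.EllipticCurves.Rank1Residual
  Literature.NumberTheory.Automorphic
  Summit.BirchSwinnertonDyer.Rank1Residual.F1Sign2
  Summit.BirchSwinnertonDyer.Rank1Residual


/-- **A parametrisation datum with ODD constant at level `N_E` with `4 ∤ N_E`, for `E[2]` irreducible** (the `p = 2` twin of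
`X11b.exists_modularParametrizationData_not_dvd`): the optimal curve `E₀ ~ E` of the class has a datum of minimal degree, hence
lattice-optimal (`Λ_{E₀} = c₀ Λ_f`); `2 ∤ c₀` by Abbes–Ullmo (`2 ∤ N`) or Česnavičius (`2 ∥ N`); an odd integral multiplier
`k : Λ_{E₀} → Λ_E` exists because `E[2]` is irreducible (`X11b.exists_int_mul_mem_lattice_not_dvd`, Néron mapping property);
the datum `(f, Λ_E, k c₀)` has odd constant. [cite: AbbesUllmo1996, Thm. A] [cite: Cesnavicius2018, Thm. 1.2] -/
theorem exists_modularParametrizationData_not_two_dvd (hnf : exists_isNewformOf)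
    (hAU : abbesUllmo_not_dvd_maninConstant_of_not_dvd_level)
    (hCes : cesnavicius_not_two_dvd_maninConstant_of_two_dvd_level)
    (W : WeierstrassCurve ℚ) [W.IsElliptic] [W.IsGloballyMinimal] {N : ℕ} [NeZero N]
    (hN : W.conductorNorm ℤ = N) (h4 : ¬ 4 ∣ N) (hirr : W.HasIrreducibleModPGaloisRep 2) :
    ∃ Dt : ModularParametrizationData W N, ¬ (2 : ℤ) ∣ Dt.c := by
  have hNS : integral_neronScaling_of_isGloballyMinimal := integral_neronScaling_of_isGloballyMinimal_holds
  haveI : (W.baseChange ℂ).IsElliptic := by rw [WeierstrassCurve.baseChange]; infer_instance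
  -- the optimal curve `W₀ ~ W` of the class, with its datum `D₀` of minimal degree
  obtain ⟨W₀, hW₀, hW₀min, D₀, hfW, hisoW, hmin⟩ :=
    exists_optimal_modularParametrizationData_of_modularity hnf N W hN
  haveI := hW₀
  haveI := hW₀min
  -- minimal degree forces lattice-optimality `Λ_{W₀} = c₀ Λ_f`
  obtain ⟨W₁, hW₁, D₁, hf₁, h₁⟩ := D₀.exists_optimalDatum'
  haveI := hW₁
  have hopt : ∀ z ∈ D₀.L.lattice, ∃ w ∈ periodLattice D₀.f, z = D₀.c * w :=
    D₀.latticeEq_of_modularDegree_le D₁ hf₁ h₁ (hmin W₁ D₁ hf₁)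
  -- Abbes–Ullmo (`2 ∤ N`) / Česnavičius (`2 ∥ N`): `2 ∤ c₀`
  have hc₀ : ¬ (2 : ℤ) ∣ D₀.c := by
    by_cases h2 : 2 ∣ N
    · exact hCes W₀ D₀ hopt h2 (by simpa using h4)
    · exact hAU W₀ D₀ hopt 2 Nat.prime_two h2
  -- an integral multiplier `k : Λ_{W₀} → Λ_W` prime to `2`
  obtain ⟨LW, hLW⟩ := exists_isNeronLatticeOf_holds (W.baseChange ℂ)
  obtain ⟨k, hk0, hpk, hk⟩ :=
    X11b.exists_int_mul_mem_lattice_not_dvd hNS hisoW.symm_of_charZero D₀.isNeronLattice hLW Nat.prime_two hirr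
  -- the datum `(f, Λ_W, k c₀)` of `W`
  have hm0 : k * D₀.c ≠ 0 := mul_ne_zero hk0 D₀.maninConstant_ne_zero_holds
  have hle : ∀ z ∈ periodLattice D₀.f, ((k * D₀.c : ℤ) : ℂ) * z ∈ LW.lattice := fun z hz ↦ by
    have h2 := hk _ (D₀.smul_periodLattice_le z hz)
    rwa [← mul_assoc, ← Int.cast_mul] at h2
  obtain ⟨D, -, -, hDc⟩ := ModularParametrizationData.exists_of_isNewformOf hfW hLW hm0 hle
  refine ⟨D, fun hdvd ↦ ?_⟩
  rw [hDc] at hdvd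
  rcases (Nat.prime_iff_prime_int.mp Nat.prime_two).dvd_or_dvd hdvd with h | h
  · exact hpk h
  · exact hc₀ h

/-- `E(ℚ)[2] = 0` (the `2`-division cubic has no rational root) is irreducibility of `E[2]`. -/
theorem irr_two_of_noRationalTwoTorsion (W : WeierstrassCurve ℚ) [W.IsElliptic] (hT : NoRationalTwoTorsion W) :
    W.HasIrreducibleModPGaloisRep 2 :=
  (X5.O1.irr_two_iff_forall_two_nsmul W).mpr (EggDoubling.eq_zero_of_two_smul_eq_zero W hT)

/-- **The Manin stub split**: `S_manin` from PRINT at `4 ∤ N` (Abbes–Ullmo, Česnavičius, modularity) and the OPEN residue at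
additive level `4 ∣ N`. -/
theorem s_manin_of (hPub : S_maninPub) (hAdd : ManinOddAdditiveLevelAtTwo) : S_manin := by
  intro W _ _ _ hT2
  by_cases h4 : 4 ∣ W.conductorNorm ℤ
  · exact hAdd W hT2 h4
  · exact exists_modularParametrizationData_not_two_dvd hPub.1 hPub.2.1 hPub.2.2 W rfl h4
      (irr_two_of_noRationalTwoTorsion W hT2)

end Summit.BirchSwinnertonDyer.BirchSwinnertonDyer.Theorems.RankOneAtTwoOneDoor

end
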